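import Literature.MathematicalPhysics.QuantumLattice.LiebFluxPhaseSplit
import Literature.MathematicalPhysics.QuantumLattice.HubbardLiebConfig
import HarnessLib

/-!
# The spin factorisation `𝓕(Λ × {↑,↓}) ≅ 𝓕(Λ) ⊗ 𝓕(Λ)` of the Hubbard Fock space in Kronecker form

Topic `MathematicalPhysics/QuantumLattice`, family `hubbard`. The tree's concrete Jordan–Wigner Fock
space of the Hubbard model lives on the SITE-major orbital order `Orb Λ = Λ ×ₗ Fin 2`
(`x₁↑ < x₁↓ < x₂↑ < ⋯`, `HubbardWave0`), in which a same-spin hopping `c†_{xσ} c_{yσ}` drags a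
Jordan–Wigner string through the opposite-spin orbitals in between, so the textbook factorisation
"`H = T ⊗ 1 + 1 ⊗ T + U Σ_x n_x ⊗ n_x`" (Lieb 1989, eq. (4): `W ↦ KW + WK + U Σ L_x W L_x`; Kubo–Kishi
1990; Fröhlich–Israel–Lieb–Simon 1978 §3 ex. 3) is not an identity of matrices in that basis. It
becomes one after relabelling the orbitals to the SPIN-major ordered sum `Λ ⊕ₗ Λ` (all `↑` before
all `↓`): the tree's `relabel` (`FermionRelabelling`, the Bogoliubov automorphism of ANY orbital
bijection, with the correct signs) composed with the splitting of configurations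
`𝒫(Λ ⊕ Λ) ≃ 𝒫 Λ × 𝒫 Λ` of `LiebFluxPhaseKronecker` (`JWSplit.splitAlgEquiv`,
`c_{inl x} = c_x ⊗ 1`, `c_{inr x} = P ⊗ c_x`). This file packages that composition:

* `spinSplit : Orb Λ ≃ Λ ⊕ₗ Λ`, `(x,↑) ↦ inl x`, `(x,↓) ↦ inr x`;
* `spinSplitHom : Matrix (𝒫(Orb Λ)) ≃ₐ[ℂ] Matrix (𝒫 Λ × 𝒫 Λ)`, `Φ = split ∘ relabel spinSplit`;
* the images `Φ(c_{x↑}) = c_x ⊗ 1`, `Φ(c_{x↓}) = P ⊗ c_x`, `Φ(c†_{x↑}c_{y↑}) = (c†_x c_y) ⊗ 1`,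
  `Φ(c†_{x↓}c_{y↓}) = 1 ⊗ (c†_x c_y)`, `Φ(n_{x↑} n_{x↓}) = n_x ⊗ n_x`, `Φ(N) = N ⊗ 1 + 1 ⊗ N`,
  `Φ(P) = P ⊗ P`, and the **Kronecker form of the (grand-canonical) Hubbard Hamiltonian**
  `Φ(H(t,U) - μN) = K ⊗ 1 + 1 ⊗ K + U Σ_x n_x ⊗ n_x`, `K = hoppingMatrix G t - μ N` (the spinless
  hopping of `HubbardLiebConfig`), valid on the WHOLE Fock space (all `(N↑, N↓)` sectors, unlike
  the sector-wise coefficient-matrix transfer `liebW` of `HubbardWave0LiebProofs`);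
* invariance of the trace and covariance of `NormedSpace.exp` / Gibbs weights under `Φ`.

Everything is proved; no named facts. Consumers: trace identities of the Kubo–Kishi /
reflection-positivity type (`Summit…ParityLeeYang.AttractiveParityNonneg` via
`FrohlichIsraelLiebSimon1978_thm21_matrix`).

## References

* E. H. Lieb, *Two theorems on the Hubbard model*, PRL 62 (1989) 1201, eq. (4). [LiebPRL1989]
* K. Kubo, T. Kishi, Phys. Rev. B 41 (1990) 4866, proof of Thm 1. [KuboKishi1990]
* J. Fröhlich, R. Israel, E. H. Lieb, B. Simon, CMP 62 (1978) 1, §3 example 3. [FrohlichIsraelLiebSimon1978]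
* O. Bratteli, D. W. Robinson, *Operator Algebras and QSM II*, §5.2.2, Thm 5.2.5. [BratteliRobinsonII1997]
-/

noncomputable section

namespace Literature.MathematicalPhysics.QuantumLattice

open Matrix Finset HubbardWave0 JWSplit
open scoped Kronecker

section SpinSplit

variable {Λ : Type*}

/-- **The spin splitting of the orbitals** `Orb Λ = Λ ×ₗ Fin 2 ≃ Λ ⊕ₗ Λ`: `(x, ↑) ↦ inl x`,
`(x, ↓) ↦ inr x` (all up orbitals before all down orbitals). [cite: LiebPRL1989, proof of Theorem 1 (`ψ = Σ W_{αβ} ψ^α_↑ ⊗ ψ^β_↓`)] -/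
def spinSplit : Orb Λ ≃ Λ ⊕ₗ Λ where
  toFun i := if (ofLex i).2 = 0 then toLex (Sum.inl (ofLex i).1) else toLex (Sum.inr (ofLex i).1)
  invFun j := Sum.elim (fun x => orb x 0) (fun x => orb x 1) (ofLex j)
  left_inv i := by
    rcases orb_cases i with h | h
    · rw [h]
      simp [orb]
    · rw [h]
      simp [orb]
  right_inv j := by
    obtain ⟨j, rfl⟩ := (toLex : Λ ⊕ Λ ≃ Λ ⊕ₗ Λ).surjective j
    rcases j with x | x
    · simp [orb]
    · simp [orb]

/-- An up orbital goes to the left summand. [folklore] -/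
@[simp] theorem spinSplit_orb_zero (x : Λ) : spinSplit (orb x 0) = toLex (Sum.inl x) := by
  simp [spinSplit, orb]

/-- A down orbital goes to the right summand. [folklore] -/
@[simp] theorem spinSplit_orb_one (x : Λ) : spinSplit (orb x 1) = toLex (Sum.inr x) := by
  simp [spinSplit, orb]

variable [LinearOrder Λ] [Fintype Λ]

/-- **The spin factorisation isomorphism** `Φ = split ∘ relabel spinSplit` of the Fock-space matrix
algebra of `Orb Λ` onto the matrices on `𝒫 Λ × 𝒫 Λ` (up configurations × down configurations).
[cite: LiebPRL1989, eq. (4)] -/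
def spinSplitHom : Matrix (Finset (Orb Λ)) (Finset (Orb Λ)) ℂ ≃ₐ[ℂ]
    Matrix (Finset Λ × Finset Λ) (Finset Λ × Finset Λ) ℂ :=
  (relabel spinSplit).trans splitAlgEquiv

/-- Unfolding lemma. [folklore] -/
theorem spinSplitHom_apply (a : Matrix (Finset (Orb Λ)) (Finset (Orb Λ)) ℂ) :
    spinSplitHom a = splitAlgEquiv (relabel (spinSplit (Λ := Λ)) a) := rfl

/-- `Φ(c†_{x↑}) = c†_x ⊗ 1`. [cite: BratteliRobinsonII1997, §5.2.2, Thm. 5.2.5] -/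
theorem spinSplitHom_creation_zero (x : Λ) :
    spinSplitHom (creation (orb x 0)) = creation x ⊗ₖ (1 : Matrix (Finset Λ) (Finset Λ) ℂ) := by
  rw [spinSplitHom_apply, relabel_creation, spinSplit_orb_zero, splitAlgEquiv_apply,
    reindex_creation_inl]

/-- `Φ(c_{x↑}) = c_x ⊗ 1`. [cite: BratteliRobinsonII1997, §5.2.2, Thm. 5.2.5] -/
theorem spinSplitHom_annihilation_zero (x : Λ) :
    spinSplitHom (annihilation (orb x 0)) = annihilation x ⊗ₖ (1 : Matrix (Finset Λ) (Finset Λ) ℂ) := by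
  rw [spinSplitHom_apply, relabel_annihilation, spinSplit_orb_zero, splitAlgEquiv_apply,
    reindex_annihilation_inl]

/-- `Φ(c†_{x↓}) = P ⊗ c†_x` (`P = (-1)^{N↑}`, the Jordan–Wigner string through all up orbitals).
[cite: BratteliRobinsonII1997, §5.2.2, Thm. 5.2.5] -/
theorem spinSplitHom_creation_one (x : Λ) :
    spinSplitHom (creation (orb x 1)) = (parityOp : Matrix (Finset Λ) (Finset Λ) ℂ) ⊗ₖ creation x := by
  rw [spinSplitHom_apply, relabel_creation, spinSplit_orb_one, splitAlgEquiv_apply,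
    reindex_creation_inr]

/-- `Φ(c_{x↓}) = P ⊗ c_x`. [cite: BratteliRobinsonII1997, §5.2.2, Thm. 5.2.5] -/
theorem spinSplitHom_annihilation_one (x : Λ) :
    spinSplitHom (annihilation (orb x 1)) =
      (parityOp : Matrix (Finset Λ) (Finset Λ) ℂ) ⊗ₖ annihilation x := by
  rw [spinSplitHom_apply, relabel_annihilation, spinSplit_orb_one, splitAlgEquiv_apply,
    reindex_annihilation_inr]

/-- **Up bilinears**: `Φ(c†_{x↑} c_{y↑}) = (c†_x c_y) ⊗ 1` (Lieb's `K W`). [cite: LiebPRL1989, eq. (4)] -/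
theorem spinSplitHom_hop_zero (x y : Λ) :
    spinSplitHom (creation (orb x 0) * annihilation (orb y 0)) =
      (creation x * annihilation y) ⊗ₖ (1 : Matrix (Finset Λ) (Finset Λ) ℂ) := by
  rw [map_mul, spinSplitHom_creation_zero, spinSplitHom_annihilation_zero, ← mul_kronecker_mul,
    Matrix.mul_one]

/-- **Down bilinears**: `Φ(c†_{x↓} c_{y↓}) = 1 ⊗ (c†_x c_y)` (Lieb's `W K`; the two parity strings
cancel). [cite: LiebPRL1989, eq. (4)] -/
theorem spinSplitHom_hop_one (x y : Λ) :
    spinSplitHom (creation (orb x 1) * annihilation (orb y 1)) =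
      (1 : Matrix (Finset Λ) (Finset Λ) ℂ) ⊗ₖ (creation x * annihilation y) := by
  rw [map_mul, spinSplitHom_creation_one, spinSplitHom_annihilation_one, ← mul_kronecker_mul,
    JWSplit.parityOp_mul_parityOp]

/-- Same-spin bilinears, both spins at once. [cite: LiebPRL1989, eq. (4)] -/
theorem spinSplitHom_hop (x y : Λ) (σ : Fin 2) :
    spinSplitHom (creation (orb x σ) * annihilation (orb y σ)) =
      if σ = 0 then (creation x * annihilation y) ⊗ₖ (1 : Matrix (Finset Λ) (Finset Λ) ℂ)
      else (1 : Matrix (Finset Λ) (Finset Λ) ℂ) ⊗ₖ (creation x * annihilation y) := by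
  fin_cases σ
  · exact spinSplitHom_hop_zero x y
  · exact spinSplitHom_hop_one x y

/-- `Φ(n_{x↑}) = n_x ⊗ 1`. [cite: LiebPRL1989, eq. (4)] -/
theorem spinSplitHom_numberOp_zero (x : Λ) :
    spinSplitHom (numberOp x 0) = numberAt x ⊗ₖ (1 : Matrix (Finset Λ) (Finset Λ) ℂ) :=
  spinSplitHom_hop_zero x x

/-- `Φ(n_{x↓}) = 1 ⊗ n_x`. [cite: LiebPRL1989, eq. (4)] -/
theorem spinSplitHom_numberOp_one (x : Λ) :
    spinSplitHom (numberOp x 1) = (1 : Matrix (Finset Λ) (Finset Λ) ℂ) ⊗ₖ numberAt x :=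
  spinSplitHom_hop_one x x

/-- **The on-site interaction factorises**: `Φ(n_{x↑} n_{x↓}) = n_x ⊗ n_x` (Lieb's `L_x W L_x`).
[cite: LiebPRL1989, eq. (4)] -/
theorem spinSplitHom_interaction (x : Λ) :
    spinSplitHom (numberOp x 0 * numberOp x 1) = numberAt x ⊗ₖ numberAt x := by
  rw [map_mul, spinSplitHom_numberOp_zero, spinSplitHom_numberOp_one,
    kronecker_one_mul_one_kronecker]

/-- `Φ(1) = 1 ⊗ 1`. [folklore] -/
theorem spinSplitHom_one :
    spinSplitHom (1 : Matrix (Finset (Orb Λ)) (Finset (Orb Λ)) ℂ) =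
      (1 : Matrix (Finset Λ) (Finset Λ) ℂ) ⊗ₖ (1 : Matrix (Finset Λ) (Finset Λ) ℂ) := by
  rw [map_one, one_kronecker_one]

/-- **The particle number splits**: `Φ(N) = N ⊗ 1 + 1 ⊗ N` (spinless `N = totalNumberOp`). [folklore] -/
theorem spinSplitHom_totalNumber :
    spinSplitHom (totalNumber : Matrix (Finset (Orb Λ)) (Finset (Orb Λ)) ℂ) =
      totalNumberOp ⊗ₖ (1 : Matrix (Finset Λ) (Finset Λ) ℂ) +
        (1 : Matrix (Finset Λ) (Finset Λ) ℂ) ⊗ₖ totalNumberOp := by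
  rw [totalNumber, map_sum, totalNumberOp, sum_kronecker, kronecker_sum, ← Finset.sum_add_distrib]
  refine Finset.sum_congr rfl fun x _ => ?_
  rw [Fin.sum_univ_two, map_add, spinSplitHom_numberOp_zero, spinSplitHom_numberOp_one]

variable (G : SimpleGraph Λ) [DecidableRel G.Adj]

/-- **Kronecker form of the Hubbard Hamiltonian on the whole Fock space**:
`Φ(H(t,U)) = T ⊗ 1 + 1 ⊗ T + U Σ_x n_x ⊗ n_x`, `T = hoppingMatrix G t` the spinless hopping
(Lieb's `W ↦ KW + WK + U Σ_x L_x W L_x`, here for all `(N↑,N↓)` sectors at once). [cite: LiebPRL1989, eq. (4)] -/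
theorem spinSplitHom_hamiltonian (t U : ℝ) :
    spinSplitHom (hamiltonian G t U) =
      hoppingMatrix G t ⊗ₖ (1 : Matrix (Finset Λ) (Finset Λ) ℂ) +
        (1 : Matrix (Finset Λ) (Finset Λ) ℂ) ⊗ₖ hoppingMatrix G t +
        (U : ℂ) • ∑ x : Λ, numberAt x ⊗ₖ numberAt x := by
  have hhop : ∀ (x y : Λ) (σ : Fin 2),
      spinSplitHom (if G.Adj x y then creation (orb x σ) * annihilation (orb y σ) else 0) =
        if G.Adj x y then spinSplitHom (creation (orb x σ) * annihilation (orb y σ)) else 0 := by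
    intro x y σ
    split_ifs
    · rfl
    · rw [map_zero]
  -- the hopping sum splits into the up and the down Kronecker blocks
  have hT : spinSplitHom (∑ x : Λ, ∑ y : Λ, ∑ σ : Fin 2,
      if G.Adj x y then creation (orb x σ) * annihilation (orb y σ) else
        (0 : Matrix (Finset (Orb Λ)) (Finset (Orb Λ)) ℂ)) =
      (∑ x : Λ, ∑ y : Λ, if G.Adj x y then creation x * annihilation y else
        (0 : Matrix (Finset Λ) (Finset Λ) ℂ)) ⊗ₖ (1 : Matrix (Finset Λ) (Finset Λ) ℂ) +
      (1 : Matrix (Finset Λ) (Finset Λ) ℂ) ⊗ₖ (∑ x : Λ, ∑ y : Λ,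
        if G.Adj x y then creation x * annihilation y else (0 : Matrix (Finset Λ) (Finset Λ) ℂ)) := by
    rw [sum_kronecker, kronecker_sum, ← Finset.sum_add_distrib, map_sum]
    refine Finset.sum_congr rfl fun x _ => ?_
    rw [sum_kronecker, kronecker_sum, ← Finset.sum_add_distrib, map_sum]
    refine Finset.sum_congr rfl fun y _ => ?_
    rw [map_sum, Fin.sum_univ_two, hhop, hhop, spinSplitHom_hop_zero, spinSplitHom_hop_one,
      ite_kronecker, kronecker_ite]
  have hV : spinSplitHom (∑ x : Λ, numberOp x 0 * numberOp x 1) = ∑ x : Λ, numberAt x ⊗ₖ numberAt x := by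
    rw [map_sum]
    exact Finset.sum_congr rfl fun x _ => spinSplitHom_interaction x
  unfold hamiltonian
  rw [map_add, map_smul, map_smul, hT, hV, hoppingMatrix, smul_add, smul_kronecker, kronecker_smul]

/-- **Kronecker form of the grand-canonical Hubbard Hamiltonian**:
`Φ(H(t,U) - μN) = K ⊗ 1 + 1 ⊗ K + U Σ_x n_x ⊗ n_x` with `K = hoppingMatrix G t - μ N`.
[cite: KuboKishi1990, proof of Thm 1] -/
theorem spinSplitHom_hamiltonianWith (t U μ : ℝ) :
    spinSplitHom (hamiltonianWith G t U μ) =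
      (hoppingMatrix G t - (μ : ℂ) • totalNumberOp) ⊗ₖ (1 : Matrix (Finset Λ) (Finset Λ) ℂ) +
        (1 : Matrix (Finset Λ) (Finset Λ) ℂ) ⊗ₖ (hoppingMatrix G t - (μ : ℂ) • totalNumberOp) +
        (U : ℂ) • ∑ x : Λ, numberAt x ⊗ₖ numberAt x := by
  rw [hamiltonianWith, map_sub, map_smul, spinSplitHom_hamiltonian, spinSplitHom_totalNumber,
    sub_kronecker, kronecker_sub, smul_kronecker, kronecker_smul, smul_add]
  abel

omit [Fintype Λ] in
/-- Relabelling the orbitals fixes the fermion parity (a function of the particle number only).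
[folklore] -/
theorem relabel_spinSplit_parityOp [Fintype Λ] :
    relabel (spinSplit (Λ := Λ)) (parityOp : Matrix (Finset (Orb Λ)) (Finset (Orb Λ)) ℂ) = parityOp := by
  ext s' t'
  obtain ⟨s, rfl⟩ := (spinSplit (Λ := Λ)).finsetCongr.surjective s'
  obtain ⟨t, rfl⟩ := (spinSplit (Λ := Λ)).finsetCongr.surjective t'
  rw [relabel_apply_finsetCongr]
  simp only [parityOp, diagonal_apply]
  by_cases h : s = t
  · subst h
    rw [if_pos rfl, if_pos rfl, Equiv.finsetCongr_apply, Finset.card_map, mul_comm (relabelSign _ s),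
      mul_assoc, relabelSign_mul_self, mul_one]
  · rw [if_neg h, if_neg (fun h' => h ((spinSplit (Λ := Λ)).finsetCongr.injective h')), mul_zero,
      zero_mul]

/-- **The fermion parity factorises**: `Φ((-1)^N) = (-1)^{N↑} ⊗ (-1)^{N↓}`. [folklore] -/
theorem spinSplitHom_parityOp :
    spinSplitHom (parityOp : Matrix (Finset (Orb Λ)) (Finset (Orb Λ)) ℂ) =
      (parityOp : Matrix (Finset Λ) (Finset Λ) ℂ) ⊗ₖ (parityOp : Matrix (Finset Λ) (Finset Λ) ℂ) := by
  rw [spinSplitHom_apply, relabel_spinSplit_parityOp, splitAlgEquiv_apply]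
  ext ⟨a, b⟩ ⟨a', b'⟩
  simp only [reindex_apply, submatrix_apply, kroneckerMap_apply, parityOp, diagonal_apply,
    Equiv.apply_eq_iff_eq, Prod.mk.injEq]
  by_cases ha : a = a' <;> by_cases hb : b = b'
  · subst ha; subst hb
    rw [if_pos ⟨rfl, rfl⟩, if_pos rfl, if_pos rfl, card_splitEquiv_symm, pow_add]
  · rw [if_neg (fun h => hb h.2), if_neg hb, mul_zero]
  · rw [if_neg (fun h => ha h.1), if_neg ha, zero_mul]
  · rw [if_neg (fun h => ha h.1), if_neg ha, zero_mul]

/-- **The trace is invariant** under the spin factorisation. [folklore] -/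
theorem trace_spinSplitHom (a : Matrix (Finset (Orb Λ)) (Finset (Orb Λ)) ℂ) :
    (spinSplitHom a).trace = a.trace := by
  rw [spinSplitHom_apply, splitAlgEquiv_apply, reindex_apply, ← trace_relabel spinSplit a,
    Matrix.trace, Matrix.trace]
  exact Fintype.sum_equiv splitEquiv.symm _ _ fun p => rfl

/-- The spin factorisation is continuous (finite dimensions). [folklore] -/
theorem continuous_spinSplitHom :
    Continuous (spinSplitHom : Matrix (Finset (Orb Λ)) (Finset (Orb Λ)) ℂ → _) :=
  (spinSplitHom (Λ := Λ)).toLinearMap.continuous_of_finiteDimensional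

/-- **The spin factorisation commutes with the matrix exponential.** [folklore] -/
theorem spinSplitHom_exp (X : Matrix (Finset (Orb Λ)) (Finset (Orb Λ)) ℂ) :
    spinSplitHom (NormedSpace.exp X) = NormedSpace.exp (spinSplitHom X) :=
  open scoped Matrix.Norms.Operator in
    NormedSpace.map_exp (spinSplitHom (Λ := Λ)) continuous_spinSplitHom X

/-- Gibbs weights are covariant: `Φ(e^{-βH}) = e^{-β Φ(H)}`. [folklore] -/
theorem spinSplitHom_gibbsWeight (β : ℝ) (H : Matrix (Finset (Orb Λ)) (Finset (Orb Λ)) ℂ) :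
    spinSplitHom (gibbsWeight β H) = gibbsWeight β (spinSplitHom H) := by
  rw [gibbsWeight, gibbsWeight, spinSplitHom_exp, map_smul]

end SpinSplit

end Literature.MathematicalPhysics.QuantumLattice

end
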